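import Summits.QuantumFields.YangMills.Theorems.BalabanUVNodesN08AlphaEq324RowCumLetterModel
import Summits.QuantumFields.YangMills.Theorems.BalabanUVNodesN08AlphaEq324RowRangeZero

/-!
# Route «BalabanUVNodes», Track-A DAG node N08 = [Balaban1985UV3] Thm 1 p. 257 ∕ Thm 2 p. 272 — THE PRICE OF A LETTER CHANGE IN THE (3.24) ROW, and the re-lettered
# core (α) clause AT ZERO DATA for an ARBITRARY cumulant letter (A6 status of `…RowCumLetter.RunAlphaEq324CoreLTAt` beyond the lane's letter)

Cell `pub-ymgap`, seat `pub-ymgap-dag-n08-w4` gen 2 (INTENT-4; sequel of `…RowCumLetter` p597105 ✓ ∕ `…RowCumLetterModel` p598498 ✓ and of gen 0's `…RowRangeZero` p591380 ✓).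
`bears_on: R4∕N08`; filed `--supports stmt-QuantumFields-20542` (K1⁷).  THEOREMS ONLY (def-free, sorry-free, standard axioms).

WHAT IS PROVED.
* §1 THE PRICE OF A LETTER CHANGE.  `eq324_of_letterChange`: an `Eq324` at letter `c` with constant `C` and a comparison `|Σ_{n≤n̄} (c′ n − c n)∕n!| ≤ C′·s^κ·vol` give the
  `Eq324` at letter `c′` with constant `C + C′` (same `s, κ, vol`); `h324RowAt_of_letterChange`: the (3.24) row at letter `c′` with the booked constant `Ca + Cc` from the row
  at letter `c` with a constant `C₁` and a per-`(h, U)` comparison budget `C′` as soon as `C₁ + C′ ≤ Ca + Cc`.  THIS IS WHAT KEEPING THE LANE'S χ-WEIGHTED LETTER WOULD COST on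
  top of the [2]-road (free letter): the comparison of the first `n̄` χ-weighted and free cumulants at the rate `(Lᵏg₀²)^{3+κ₀}|T₁^{(k)}|` (dag-n08-d `N08-ALPHA-LOCATED-g7.md` (r12):
  extensive, class II) — priced additively, and ONLY for the (3.24) row: the G3D-02 row `hG` is tied to the chart activities by `hact` and does not move with the letter.
* §2 `stepCoreLTAt_congr_sum` ∕ `coreLTAt_congr_sum`: both cumulant-reading rows read only the weighted SUM `U ↦ Σ_{n≤n̄} c k h U n∕n!`, so two letters with the same sums
  give the same clause (refines `…RowCumLetter.stepCoreLTAt_congr`).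
* §3 ZERO DATA AT AN ARBITRARY LETTER (A6).  ★ `stepCoreLTAt_zero_iff` ∕ ★ `coreLTAt_zero_iff`: over gen 0's zero run `zeroRun 𝔊 𝔠` and zero range-honest bundle `zeroAlphaLT`
  (family member `g²ε₀ ≤ 1`, EVERY record), the re-lettered clause at letter `c` holds IFF the weighted sums of `c` vanish on the run (`∀ k < K, h, U, Σ_{n≤n̄} c k h U n∕n! = 0` —
  forced by the EMPTY graph carrier of the zero series through `hG`) AND the residual pair R3D-01∕02 AND the class-I rows (gen 0's `runAlphaEq324CoreLT_zero_iff` is the instance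
  `c := (𝔖 ·).cum`, whose sums vanish identically); `coreLTAt_zero_of_pairs`; and the FREE moment-cumulant letter of the zero run (`cumulantOf (m ↦ ∫ 0ᵐ d δ) n = 0` for `n ≥ 1`,
  `moments_zeroRun` ∕ `freeLetter_zeroRun_eq_zero`) is such a letter: ★ `coreLTAt_zero_freeLetter_iff` ∕ `coreLTAt_zero_freeLetter_of_pairs` — so the END theorems of
  `…RowCumLetterEnd` at the free letter have an inhabited hypothesis for every record, modulo the residual pair and the class-I rows, exactly as at the lane's letter.
HONEST SCOPE.  Hypothesis-shape bookkeeping; zero data decide nothing about [B10]; N08 NOT discharged; count-neutral; one finite 𝕋⁴ programme at fixed ε, d = 3 tori inside the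
record; nothing continuum ∕ ℝ⁴ ∕ OS ∕ mass gap ∕ Clay — R4 closes the conditional finite-𝕋⁴ rung `BalabanLadder.UV` only.
-/

noncomputable section

namespace Summit.QuantumFields.YangMills.Theorems.BalabanUVNodesN08AlphaEq324RowCumLetterZero

open MeasureTheory
open scoped BigOperators Nat
open Literature.MathematicalPhysics.QuantumFieldTheory.Balaban1983to89
open Literature.MathematicalPhysics.QuantumFieldTheory.Balaban1983to89.B1Sect3Statements (Eq324)
open Literature.MathematicalPhysics.QuantumFieldTheory.Balaban1983to89.B1Eq324BenfattoSpecialisation (cumulantOf_eq_zero_of_moments_eq_zero)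
open Literature.MathematicalPhysics.QuantumFieldTheory.Balaban1985CMP102.Setting
open Literature.Probability.LatticeModels (cumulantOf)
open Summit.QuantumFields.Balaban3D.Carriers
open Summit.QuantumFields.Balaban3D.Proofs.Inputs
open Summit.QuantumFields.Balaban3D.Proofs.Primitives (AlphaConsts)
open Summit.QuantumFields.Balaban3D.Proofs.GroupModelLieC (lieC)
open Summit.QuantumFields.Balaban3D.Proofs.UVStability3DInputs
open Summit.QuantumFields.Balaban3D.Proofs.Bound55Std (Fibre49 Fibre57Low)
open Summit.QuantumFields.Balaban3D.Proofs.ScalesArithmetic (g0sq_pos L_pos sites_nonneg)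
open Summit.QuantumFields.YangMills.Theorems.BalabanUVNodesN08AlphaClassI (RunRowsI)
open Summit.QuantumFields.YangMills.Theorems.BalabanUVNodesN08AlphaZeroData (zeroRun zeroSeries_cum zeroSeries_𝒱 zeroSeries_Gt_supp)
open Summit.QuantumFields.YangMills.Theorems.BalabanUVNodesN08AlphaEq324RowSocket (eq324_mono)
open Summit.QuantumFields.YangMills.Theorems.BalabanUVNodesN08AlphaEq324RowRange (AlphaDataLT RunAlphaEq324CoreLT)
open Summit.QuantumFields.YangMills.Theorems.BalabanUVNodesN08AlphaEq324RowRangeZero (zeroAlphaLT stepAlphaEq324CoreLT_zero_iff runAlphaEq324CoreLT_zero_iff)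
open Summit.QuantumFields.YangMills.Theorems.BalabanUVNodesN08AlphaEq324RowCumLetter

variable {L : ℕ}

/-! ## §1 The price of a letter change in an `Eq324` row -/

section Price

/-- **LETTER CHANGE, PRICED**: an `Eq324` at letter `c` with constant `C` and a comparison of the weighted sums `|Σ_{n≤n̄} c′ n∕n! − Σ_{n≤n̄} c n∕n!| ≤ C′·s^κ·vol` give the
`Eq324` at letter `c′` with constant `C + C′` (witness `r′ = r + Σc − Σc′`). [cite: Balaban1982Higgs1, (3.24) p.616 (bookkeeping)] -/
theorem eq324_of_letterChange {lhs : ℝ} {c c' : ℕ → ℝ} {nbar : ℕ} {C C' s κ vol : ℝ} (h : Eq324 lhs c nbar C s κ vol)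
    (hcmp : |∑ n ∈ Finset.Icc 1 nbar, c' n / (n.factorial : ℝ) - ∑ n ∈ Finset.Icc 1 nbar, c n / (n.factorial : ℝ)| ≤ C' * s ^ κ * vol) :
    Eq324 lhs c' nbar (C + C') s κ vol := by
  obtain ⟨r, hr, hlhs⟩ := h
  refine ⟨r + (∑ n ∈ Finset.Icc 1 nbar, c n / (n.factorial : ℝ) - ∑ n ∈ Finset.Icc 1 nbar, c' n / (n.factorial : ℝ)), ?_, ?_⟩
  · calc |r + (∑ n ∈ Finset.Icc 1 nbar, c n / (n.factorial : ℝ) - ∑ n ∈ Finset.Icc 1 nbar, c' n / (n.factorial : ℝ))|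
          ≤ |r| + |∑ n ∈ Finset.Icc 1 nbar, c n / (n.factorial : ℝ) - ∑ n ∈ Finset.Icc 1 nbar, c' n / (n.factorial : ℝ)| := abs_add_le _ _
      _ ≤ C * s ^ κ * vol + C' * s ^ κ * vol := add_le_add hr (by rwa [abs_sub_comm])
      _ = (C + C') * s ^ κ * vol := by ring
  · rw [hlhs]
    congr 1
    ring

variable {S : Scales L} {G : Type} [GaugeGroup G] [MeasurableSpace G] [HaarData G] (𝔊 : GroupModel G) (𝔠 : AlphaConsts L 𝔊.N)
  (𝔖 : ∀ k, StepSeries S G ↥(lieC 𝔊) (nblkOf S 𝔠.lane.carrier k) k) (k : ℕ)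
  (c c' : Hist S.P (k + 1) → GaugeField S.P (k + 1) G → ℕ → ℝ)

/-- **THE (3.24) ROW AT LETTER `c′` FROM THE ROW AT LETTER `c` PLUS A COMPARISON**: if the row holds at `c` with a constant `C₁`, the weighted sums of `c′` and `c` differ by at
most `C′·(Lᵏg₀²)^{3+κ₀}·|T₁^{(k)}|` per `(h, U)`, and `C₁ + C′ ≤ Ca + Cc`, then the row holds at `c′` with the booked constant — what keeping the χ-weighted letter costs on top of
a free-letter supplier (or vice versa): the cumulant comparison, additively.  (The G3D-02 row does NOT move with the letter: its activities are the chart's, `hact`.)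
[cite: Balaban1982Higgs1, (3.24) p.616; Balaban1985UV3, (58) p.270] -/
theorem h324RowAt_of_letterChange {C₁ C' : ℝ} (hle : C₁ + C' ≤ 𝔠.Ca + 𝔠.Cc)
    (hrow : ∀ h (U : GaugeField S.P (k + 1) G),
      Eq324 (∫ ω in (𝔖 k).box h, Real.exp ((𝔖 k).𝒱 h U ω) ∂(𝔖 k).μ) (c h U) 𝔠.nbar C₁ ((L : ℝ) ^ k * S.g0sq) (3 + 𝔠.κ₀) (S.sites k))
    (hcmp : ∀ h (U : GaugeField S.P (k + 1) G),
      |∑ n ∈ Finset.Icc 1 𝔠.nbar, c' h U n / (n.factorial : ℝ) - ∑ n ∈ Finset.Icc 1 𝔠.nbar, c h U n / (n.factorial : ℝ)| ≤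
        C' * ((L : ℝ) ^ k * S.g0sq) ^ (3 + 𝔠.κ₀) * S.sites k) :
    ∀ h (U : GaugeField S.P (k + 1) G),
      Eq324 (∫ ω in (𝔖 k).box h, Real.exp ((𝔖 k).𝒱 h U ω) ∂(𝔖 k).μ) (c' h U) 𝔠.nbar (𝔠.Ca + 𝔠.Cc) ((L : ℝ) ^ k * S.g0sq) (3 + 𝔠.κ₀) (S.sites k) := by
  intro h U
  have hunit : 0 ≤ ((L : ℝ) ^ k * S.g0sq) ^ (3 + 𝔠.κ₀) * S.sites k :=
    mul_nonneg (Real.rpow_nonneg (mul_pos (pow_pos (L_pos S) k) (g0sq_pos S)).le _) (sites_nonneg S k)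
  refine eq324_mono (eq324_of_letterChange (hrow h U) (hcmp h U)) ?_
  calc (C₁ + C') * ((L : ℝ) ^ k * S.g0sq) ^ (3 + 𝔠.κ₀) * S.sites k = (C₁ + C') * (((L : ℝ) ^ k * S.g0sq) ^ (3 + 𝔠.κ₀) * S.sites k) := by ring
    _ ≤ (𝔠.Ca + 𝔠.Cc) * (((L : ℝ) ^ k * S.g0sq) ^ (3 + 𝔠.κ₀) * S.sites k) := mul_le_mul_of_nonneg_right hle hunit
    _ = (𝔠.Ca + 𝔠.Cc) * ((L : ℝ) ^ k * S.g0sq) ^ (3 + 𝔠.κ₀) * S.sites k := by ring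

end Price

/-! ## §2 Two letters with the same weighted sums give the same clause -/

section Sum

variable {S : Scales L} {G : Type} [GaugeGroup G] [MeasurableSpace G] [HaarData G] {𝔊 : GroupModel G} {𝔠 : AlphaConsts L 𝔊.N}
  {X : ExternalInputs S G} {𝔖 : ∀ k, StepSeries S G ↥(lieC 𝔊) (nblkOf S 𝔠.lane.carrier k) k} {𝔄 : AlphaDataLT 𝔊 𝔠 X 𝔖}
  {c c' : ∀ k, Hist S.P (k + 1) → GaugeField S.P (k + 1) G → ℕ → ℝ}

/-- **SUM-CONGRUENCE of the re-lettered step list**: `hG` and `h324` read only `U ↦ Σ_{n≤n̄} c k h U n∕n!`. [cite: Balaban1985UV3, (58) p.270 (bookkeeping)] -/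
theorem stepCoreLTAt_congr_sum {k : ℕ} {hk : k + 1 ≤ S.K}
    (hsum : ∀ h U, ∑ n ∈ Finset.Icc 1 𝔠.nbar, c' k h U n / (n.factorial : ℝ) = ∑ n ∈ Finset.Icc 1 𝔠.nbar, c k h U n / (n.factorial : ℝ))
    (A : StepAlphaEq324CoreLTAt 𝔊 𝔠 X 𝔖 𝔄 c k hk) : StepAlphaEq324CoreLTAt 𝔊 𝔠 X 𝔖 𝔄 c' k hk :=
  { chart := A.chart, bound28 := A.bound28, inv26 := A.inv26, far_le := A.far_le, hPY := A.hPY, hPYZ := A.hPYZ, norm35 := A.norm35,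
    logZT := A.logZT, hact := A.hact,
    hG := fun h => by simpa only [hsum h] using A.hG h,
    h324 := fun h U => by
      obtain ⟨r, hr, hlhs⟩ := A.h324 h U
      exact ⟨r, hr, by rw [hlhs, hsum h U]⟩,
    h44 := A.h44, hfloor := A.hfloor, hU := A.hU, hPm := A.hPm, hPb := A.hPb, fibre49 := A.fibre49, fibre57Low := A.fibre57Low }

/-- … and of the run clause. [cite: Balaban1985UV3, (67)–(68) p.273 (bookkeeping)] -/
theorem coreLTAt_congr_sum
    (hsum : ∀ k, k + 1 ≤ S.K → ∀ h U, ∑ n ∈ Finset.Icc 1 𝔠.nbar, c' k h U n / (n.factorial : ℝ) = ∑ n ∈ Finset.Icc 1 𝔠.nbar, c k h U n / (n.factorial : ℝ))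
    (R : RunAlphaEq324CoreLTAt 𝔊 𝔠 X 𝔖 𝔄 c) : RunAlphaEq324CoreLTAt 𝔊 𝔠 X 𝔖 𝔄 c' :=
  { steps := fun k hk => stepCoreLTAt_congr_sum (hsum k hk) (R.steps k hk), hLF67 := R.hLF67, h68 := R.h68 }

end Sum

/-! ## §3 Zero data at an arbitrary letter -/

section Zero

variable {S : Scales L} {G : Type} [GaugeGroup G] [MeasurableSpace G] [HaarData G] (𝔊 : GroupModel G) (𝔠 : AlphaConsts L 𝔊.N)
  (X : ExternalInputs S G) (c : ∀ k, Hist S.P (k + 1) → GaugeField S.P (k + 1) G → ℕ → ℝ)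

/-- The lane's χ-weighted letter has vanishing weighted sums on the zero run. [folklore] -/
theorem sum_cum_zeroRun (k : ℕ) (h : Hist S.P (k + 1)) (U : GaugeField S.P (k + 1) G) :
    ∑ n ∈ Finset.Icc 1 𝔠.nbar, (zeroRun 𝔊 𝔠 k).cum h U n / (n.factorial : ℝ) = 0 :=
  Finset.sum_eq_zero fun n _ => by rw [zeroSeries_cum, zero_div]

/-- ★ **THE RE-LETTERED CORE STEP LIST AT ZERO DATA, ANY LETTER** = «weighted sums of the letter vanish ∧ residual pair ∧ measurable minimisers» (the first conjunct is forced
by the EMPTY graph carrier of the zero series through `hG`; gen 0's `stepAlphaEq324CoreLT_zero_iff` is the instance `c := (𝔖 ·).cum`).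
[cite: Balaban1985UV3, (41) p.266 + (55)–(63) pp.269–272; Balaban1982Higgs1, (3.24) p.616] -/
theorem stepCoreLTAt_zero_iff (hle : S.g ^ 2 * S.ε₀ ≤ 1) {k : ℕ} (hk : k + 1 ≤ S.K) :
    StepAlphaEq324CoreLTAt 𝔊 𝔠 X (zeroRun 𝔊 𝔠) (zeroAlphaLT 𝔊 𝔠 X hle) c k hk ↔
      (∀ h (U : GaugeField S.P (k + 1) G), ∑ n ∈ Finset.Icc 1 𝔠.nbar, c k h U n / (n.factorial : ℝ) = 0) ∧
      ((∀ h' : Hist S.P (k + 1),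
          Fibre49 X 𝔠.lane.carrier (zeroRun 𝔊 𝔠) (fun _ => True) k (piecesW 𝔠.lane X (zeroRun 𝔊 𝔠) k) h') ∧
        Fibre57Low X 𝔠.lane.carrier (zeroRun 𝔊 𝔠) (fun _ => True) k (piecesW 𝔠.lane X (zeroRun 𝔊 𝔠) k)) ∧
      ∀ h : Hist S.P k, Measurable (X.UkH k h) := by
  constructor
  · intro A
    have hsum : ∀ h (U : GaugeField S.P (k + 1) G), ∑ n ∈ Finset.Icc 1 𝔠.nbar, c k h U n / (n.factorial : ℝ) = 0 := fun h U => by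
      have h1 := (A.hG h).1 U
      simpa [zeroSeries_Gt_supp] using h1
    have A' : StepAlphaEq324CoreLTAt 𝔊 𝔠 X (zeroRun 𝔊 𝔠) (zeroAlphaLT 𝔊 𝔠 X hle) (fun k => (zeroRun 𝔊 𝔠 k).cum) k hk :=
      stepCoreLTAt_congr_sum (c := c) (fun h U => by rw [sum_cum_zeroRun, hsum h U]) A
    exact ⟨hsum, (stepAlphaEq324CoreLT_zero_iff 𝔊 𝔠 X hle hk).1 (stepCoreLTAt_cum_iff.1 A')⟩
  · rintro ⟨hsum, H⟩
    have A' := stepCoreLTAt_cum_iff.2 ((stepAlphaEq324CoreLT_zero_iff 𝔊 𝔠 X hle hk).2 H)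
    exact stepCoreLTAt_congr_sum (c := fun k => (zeroRun 𝔊 𝔠 k).cum) (fun h U => by rw [sum_cum_zeroRun, hsum h U]) A'

/-- ★ **THE RE-LETTERED CORE RUN CLAUSE AT ZERO DATA, ANY LETTER** = «weighted sums vanish on the run ∧ residual pairs ∧ class-I rows», for EVERY record.
[cite: Balaban1985UV3, (41) p.266 + (47) p.267 + (67)–(68) p.273] -/
theorem coreLTAt_zero_iff (hle : S.g ^ 2 * S.ε₀ ≤ 1) :
    RunAlphaEq324CoreLTAt 𝔊 𝔠 X (zeroRun 𝔊 𝔠) (zeroAlphaLT 𝔊 𝔠 X hle) c ↔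
      (∀ k, k + 1 ≤ S.K → ∀ h (U : GaugeField S.P (k + 1) G), ∑ n ∈ Finset.Icc 1 𝔠.nbar, c k h U n / (n.factorial : ℝ) = 0) ∧
      (∀ k, k + 1 ≤ S.K →
        (∀ h' : Hist S.P (k + 1),
            Fibre49 X 𝔠.lane.carrier (zeroRun 𝔊 𝔠) (fun _ => True) k (piecesW 𝔠.lane X (zeroRun 𝔊 𝔠) k) h') ∧
          Fibre57Low X 𝔠.lane.carrier (zeroRun 𝔊 𝔠) (fun _ => True) k (piecesW 𝔠.lane X (zeroRun 𝔊 𝔠) k)) ∧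
      RunRowsI 𝔊 𝔠 X (zeroRun 𝔊 𝔠) := by
  constructor
  · intro R
    have hsum : ∀ k, k + 1 ≤ S.K → ∀ h (U : GaugeField S.P (k + 1) G), ∑ n ∈ Finset.Icc 1 𝔠.nbar, c k h U n / (n.factorial : ℝ) = 0 :=
      fun k hk => ((stepCoreLTAt_zero_iff 𝔊 𝔠 X c hle hk).1 (R.steps k hk)).1
    have R' : RunAlphaEq324CoreLT 𝔊 𝔠 X (zeroRun 𝔊 𝔠) (zeroAlphaLT 𝔊 𝔠 X hle) :=
      coreLTAt_cum_iff.1 (coreLTAt_congr_sum (c := c) (fun k hk h U => by rw [sum_cum_zeroRun, hsum k hk h U]) R)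
    exact ⟨hsum, (runAlphaEq324CoreLT_zero_iff 𝔊 𝔠 X hle).1 R'⟩
  · rintro ⟨hsum, H, I⟩
    have R' := coreLTAt_cum_iff.2 ((runAlphaEq324CoreLT_zero_iff 𝔊 𝔠 X hle).2 ⟨H, I⟩)
    exact coreLTAt_congr_sum (c := fun k => (zeroRun 𝔊 𝔠 k).cum) (fun k hk h U => by rw [sum_cum_zeroRun, hsum k hk h U]) R'

/-- **AN INHABITANT OF THE RE-LETTERED CLAUSE FOR EVERY RECORD AND EVERY LETTER WITH VANISHING WEIGHTED SUMS ON THE ZERO RUN**, modulo the residual pair and the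
class-I rows (A6 status of `…RowCumLetterEnd.uvStability3D_of_inputsEq324CoreLTAt(_le)`, uniform in the record). [cite: Balaban1985UV3, (41) p.266 (bookkeeping)] -/
theorem coreLTAt_zero_of_pairs (hle : S.g ^ 2 * S.ε₀ ≤ 1)
    (hsum : ∀ k, k + 1 ≤ S.K → ∀ h (U : GaugeField S.P (k + 1) G), ∑ n ∈ Finset.Icc 1 𝔠.nbar, c k h U n / (n.factorial : ℝ) = 0)
    (H : ∀ k, k + 1 ≤ S.K →
      (∀ h' : Hist S.P (k + 1),
          Fibre49 X 𝔠.lane.carrier (zeroRun 𝔊 𝔠) (fun _ => True) k (piecesW 𝔠.lane X (zeroRun 𝔊 𝔠) k) h') ∧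
        Fibre57Low X 𝔠.lane.carrier (zeroRun 𝔊 𝔠) (fun _ => True) k (piecesW 𝔠.lane X (zeroRun 𝔊 𝔠) k))
    (I : RunRowsI 𝔊 𝔠 X (zeroRun 𝔊 𝔠)) :
    ∃ 𝔄 : AlphaDataLT 𝔊 𝔠 X (zeroRun 𝔊 𝔠), RunAlphaEq324CoreLTAt 𝔊 𝔠 X (zeroRun 𝔊 𝔠) 𝔄 c :=
  ⟨zeroAlphaLT 𝔊 𝔠 X hle, (coreLTAt_zero_iff 𝔊 𝔠 X c hle).2 ⟨hsum, H, I⟩⟩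

/-! ### The free moment-cumulant letter of the zero run -/

/-- The moments of the zero potential under the zero run's (Dirac) law: `∫ 0ᵐ dδ = [m = 0]`. [folklore] -/
theorem moments_zeroRun (k : ℕ) (h : Hist S.P (k + 1)) (U : GaugeField S.P (k + 1) G) (m : ℕ) :
    ∫ ω, (zeroRun 𝔊 𝔠 k).𝒱 h U ω ^ m ∂(zeroRun 𝔊 𝔠 k).μ = if m = 0 then 1 else 0 := by
  show ∫ _ω : Unit, (0 : ℝ) ^ m ∂(Measure.dirac ()) = _
  rcases Nat.eq_zero_or_pos m with rfl | hm
  · simp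
  · simp [zero_pow hm.ne', hm.ne']

/-- **The FREE moment-cumulant letter vanishes on the zero run** (`n ≥ 1`): `cumulantOf (m ↦ ∫ 0ᵐ dδ) n = 0`. [cite: BenfattoEtAl1978, (2.7) p.147 (bookkeeping)] -/
theorem freeLetter_zeroRun_eq_zero (k : ℕ) (h : Hist S.P (k + 1)) (U : GaugeField S.P (k + 1) G) {n : ℕ} (hn : 1 ≤ n) :
    cumulantOf (fun m => ∫ ω, (zeroRun 𝔊 𝔠 k).𝒱 h U ω ^ m ∂(zeroRun 𝔊 𝔠 k).μ) n = 0 := by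
  have hmom : (fun m => ∫ ω, (zeroRun 𝔊 𝔠 k).𝒱 h U ω ^ m ∂(zeroRun 𝔊 𝔠 k).μ) = fun m => if m = 0 then (1 : ℝ) else 0 :=
    funext (moments_zeroRun 𝔊 𝔠 k h U)
  rw [hmom]
  exact cumulantOf_eq_zero_of_moments_eq_zero (by simp) (fun m hm => by simp [Nat.one_le_iff_ne_zero.1 hm]) hn

/-- ★ **THE RE-LETTERED CLAUSE AT THE FREE MOMENT-CUMULANT LETTER, AT ZERO DATA** = «residual pairs ∧ class-I rows» — the same inhabitants as at the lane's letter, for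
every record. [cite: Balaban1985UV3, (41) p.266 + (67)–(68) p.273; BenfattoEtAl1978, (2.7) p.147] -/
theorem coreLTAt_zero_freeLetter_iff (hle : S.g ^ 2 * S.ε₀ ≤ 1) :
    RunAlphaEq324CoreLTAt 𝔊 𝔠 X (zeroRun 𝔊 𝔠) (zeroAlphaLT 𝔊 𝔠 X hle)
        (fun k h U n => cumulantOf (fun m => ∫ ω, (zeroRun 𝔊 𝔠 k).𝒱 h U ω ^ m ∂(zeroRun 𝔊 𝔠 k).μ) n) ↔
      (∀ k, k + 1 ≤ S.K →
        (∀ h' : Hist S.P (k + 1),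
            Fibre49 X 𝔠.lane.carrier (zeroRun 𝔊 𝔠) (fun _ => True) k (piecesW 𝔠.lane X (zeroRun 𝔊 𝔠) k) h') ∧
          Fibre57Low X 𝔠.lane.carrier (zeroRun 𝔊 𝔠) (fun _ => True) k (piecesW 𝔠.lane X (zeroRun 𝔊 𝔠) k)) ∧
      RunRowsI 𝔊 𝔠 X (zeroRun 𝔊 𝔠) := by
  have hsum : ∀ k, k + 1 ≤ S.K → ∀ h (U : GaugeField S.P (k + 1) G),
      ∑ n ∈ Finset.Icc 1 𝔠.nbar, cumulantOf (fun m => ∫ ω, (zeroRun 𝔊 𝔠 k).𝒱 h U ω ^ m ∂(zeroRun 𝔊 𝔠 k).μ) n / (n.factorial : ℝ) = 0 :=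
    fun k _ h U => Finset.sum_eq_zero fun n hn => by rw [freeLetter_zeroRun_eq_zero 𝔊 𝔠 k h U (Finset.mem_Icc.1 hn).1, zero_div]
  rw [coreLTAt_zero_iff]
  exact ⟨fun h => h.2, fun h => ⟨hsum, h⟩⟩

/-- **AN INHABITANT AT THE FREE LETTER FOR EVERY RECORD**, modulo the residual pair and the class-I rows. [cite: Balaban1985UV3, (41) p.266 (bookkeeping)] -/
theorem coreLTAt_zero_freeLetter_of_pairs (hle : S.g ^ 2 * S.ε₀ ≤ 1)
    (H : ∀ k, k + 1 ≤ S.K →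
      (∀ h' : Hist S.P (k + 1),
          Fibre49 X 𝔠.lane.carrier (zeroRun 𝔊 𝔠) (fun _ => True) k (piecesW 𝔠.lane X (zeroRun 𝔊 𝔠) k) h') ∧
        Fibre57Low X 𝔠.lane.carrier (zeroRun 𝔊 𝔠) (fun _ => True) k (piecesW 𝔠.lane X (zeroRun 𝔊 𝔠) k))
    (I : RunRowsI 𝔊 𝔠 X (zeroRun 𝔊 𝔠)) :
    ∃ 𝔄 : AlphaDataLT 𝔊 𝔠 X (zeroRun 𝔊 𝔠), RunAlphaEq324CoreLTAt 𝔊 𝔠 X (zeroRun 𝔊 𝔠) 𝔄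
      (fun k h U n => cumulantOf (fun m => ∫ ω, (zeroRun 𝔊 𝔠 k).𝒱 h U ω ^ m ∂(zeroRun 𝔊 𝔠 k).μ) n) :=
  ⟨zeroAlphaLT 𝔊 𝔠 X hle, (coreLTAt_zero_freeLetter_iff 𝔊 𝔠 X hle).2 ⟨H, I⟩⟩

end Zero

end Summit.QuantumFields.YangMills.Theorems.BalabanUVNodesN08AlphaEq324RowCumLetterZero

end
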